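import Summits.CriticalPhenomena.PercolationContinuityZ3.Theorems.SahiMasterFamilyStrictHierarchy
import Summits.CriticalPhenomena.PercolationContinuityZ3.Theorems.SahiMasterFamilyWidthCollapse

/-!
# Sahi's hierarchy on finite preorders: the width threshold is exact

Support file of the master-family programme (crux `NoHeavyLowerTail`, stmt-CriticalPhenomena-4575; cell `prim-masterthm`, seat P4,
unit `prim-masterthm-p4-g4`).  One citable statement combining the two structural theorems of this seat on Sahi's classes `C_n`
(`SahiPositive μ n`) for ARBITRARY probability weights on finite preorders:

* COLLAPSE (`SahiWidthCollapse.sahiPositive_all_of_width'`, gen 3): on a preorder of width `≤ w` (among any `w+1` points two are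
  comparable), `w ≥ 2`, Sahi positivity of the orders `≤ w` implies Sahi positivity of every order;
* STRICTNESS (`SahiStrictHierarchy.exists_sahiPositive_below_not_at`, gen 4): there is a preorder of width `≤ w` (namely
  `P_w = {⊥ < m_1,…,m_w < ⊤}`) with a probability weight positive of every order `< w` and NOT of order `w`.

So `N(w) := min {N : on every preorder of width ≤ w, orders ≤ N imply all orders} = w` exactly, for every `w ≥ 2`
(`width_threshold_exact`).  HONEST FRAMING: general probability weights; nothing here bears on `C_n` for FKG or product measures
[Sahi2008, Conj. 5; Kahn2022, Conj. 5], which remain open.  [this work]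
-/

namespace Summit.CriticalPhenomena.PercolationContinuityZ3.Theorems

namespace SahiStrictHierarchy

open Finset
open Literature.Combinatorics.Sahi2008

/-- **The width threshold of Sahi's hierarchy is exact.**  For every `w ≥ 2`: (i) on every finite preorder of width `≤ w`, every
probability weight that is Sahi-positive of all orders `≤ w` is Sahi-positive of all orders; (ii) some probability weight on some
finite poset of width `≤ w` is Sahi-positive of all orders `< w` but not of order `w`. [this work] -/
theorem width_threshold_exact (w : ℕ) (hw : 2 ≤ w) :
    (∀ (α : Type) [Fintype α] [DecidableEq α] [Preorder α] (μ : α → ℝ), (∀ x, 0 ≤ μ x) → ∑ x, μ x = 1 →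
        (∀ y : Fin (w + 1) → α, ∃ i j, i ≠ j ∧ y i ≤ y j) → (∀ n ≤ w, SahiPositive μ n) → ∀ n, SahiPositive μ n) ∧
    (∃ μ : PW w → ℝ, (∀ x, 0 ≤ μ x) ∧ ∑ x, μ x = 1 ∧ (∀ y : Fin (w + 1) → PW w, ∃ i j, i ≠ j ∧ y i ≤ y j) ∧
        (∀ k < w, SahiPositive μ k) ∧ ¬ SahiPositive μ w) :=
  ⟨fun _ _ _ _ μ hμ0 hμ1 hwid hpos => SahiWidthCollapse.sahiPositive_all_of_width' μ hμ0 hμ1 hw hwid hpos,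
    exists_sahiPositive_below_not_at w hw⟩

end SahiStrictHierarchy

end Summit.CriticalPhenomena.PercolationContinuityZ3.Theorems
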